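import Summits.KontsevichZagierPeriods.Zeta5Search.WellPoisedFaceTailOddWindow
import Summits.KontsevichZagierPeriods.Zeta5Search.LaiDenominators
import Summits.KontsevichZagierPeriods.Zeta5Search.DualSeriesLemma19Order
import HarnessLib

/-!
# Well-poised face forms with `B` tail bricks — Lai data for the face (sharp windows, part 1)

pub-zeta5 · fam-vwp generation 8, file 9a.  HONEST FRAMING: systematic search; no irrationality claim unless
certified.  Nothing here is evidence about `ζ(5)` (or any `ζ(s)`).

The tail skeleton `tailRQ η₀ η n` of `WellPoisedFaceTailLinearFormsPF` (fam-odd; `B` tail bricks, heads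
`h₁ = h₂ = h₃ = 1`) IS Lai's box function at `r = 0`, `J = B`:
`tailRQ η₀ η n t = C_n · laiCore B 0 η₀ n η (t+1)` (`tailRQ_eq_laiCore`).  Hence fam-indep's port of
[Zudilin2004, Lemmas 15–16] (`lai_pf_exists`, `lai_pf_isInt`, `lai_pf_eq_zero_of_lt`; `LaiBrickCoefficients`)
supplies partial-fraction data for the face with the BRICK denominator and the pole WINDOWS of Lemma 16:

* `laiTailData`, `exists_laiTailData`, `tailDataOf`, `tailRQ_eq_pfEval` — data `ĉ_{o,p}` with
  `tailRQ = pfEval (η₀ n) B ĉ + 0` away from the poles (so fam-odd's `section Data` theorems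
  `tailF_eq_coef`, `tail_sum_order_zero`, `tail_sum_vanish` apply to it);
* `tailData_isInt` — `D_{(η₀−2η_(1))n}^{B−1−o} · ĉ_{o,p} ∈ ℤ` ([Zudilin2004, (8.10)]; in particular frame
  integrality `IsInt B (D_{η₀n}) ĉ`);
* `tailData_window` — `ĉ_{o,p} ≠ 0 ⇒ η_(o) n ≤ p ≤ (η₀ − η_(o)) n` for SORTED tails (Lemma 16's windows);
* `sum_oddWindow_eq` — bookkeeping: `Σ_{o<B} g(o) ζ(o+3)` over the odd window `5 ≤ s ≤ B+1` when `g`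
  vanishes at `o = 0` and at odd `o`.

Part 2 (`WellPoisedFaceTailWindows`) turns this into Lemma 19's sharp denominator
`D_{M₁}³ D_{M₂} ⋯ D_{M_B} · F(h_n) ∈ ℤ + Σ ℤζ(odd)`; the `Φ⁻¹` saving is `WellPoisedFaceTailPhi`.
-/
noncomputable section

open Finset Filter Polynomial

namespace Summit.KontsevichZagierPeriods.Zeta5Search.WellPoisedFaceRate

open Literature.NumberTheory.Transcendental (zetaValue lcmUpto_dvd_lcmUpto)
open Literature.NumberTheory.Transcendental.BallRivoal (pfEval IsInt poch harm)
open DualSeriesLemma19 (isInt_prod_mul_harm)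

variable {B : ℕ} (η₀ : ℕ) (η : Fin B → ℕ) (n : ℕ)

/-! ## 1. Sorted directions -/

/-- `etaB` at an index `< B`. -/
theorem etaB_of_lt (s : ℕ) (hs : s < B) : etaB η s = η ⟨s, hs⟩ := by
  unfold etaB; rw [dif_pos hs]

/-- `etaB` is monotone below `B` for a sorted direction. -/
theorem etaB_mono (hs : Monotone η) {a b : ℕ} (hab : a ≤ b) (hb : b < B) : etaB η a ≤ etaB η b := by
  rw [etaB_of_lt η a (lt_of_le_of_lt hab hb), etaB_of_lt η b hb]
  exact hs (Fin.mk_le_mk.2 hab)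

/-! ## 2. The face function is Lai's box function at `r = 0`, `J = B` -/

/-- Length bookkeeping: `(η₀n + 2) − 2(η_j n + 1) = (η₀ − 2η_j)·n`. -/
theorem tailLen_eq (hη : ∀ j, 2 * η j < η₀) (j : Fin B) :
    (η₀ * n + 2) - 2 * (η j * n + 1) = (η₀ - 2 * η j) * n := by
  have h2 : 2 * (η j * n) ≤ η₀ * n := by rw [← mul_assoc]; exact Nat.mul_le_mul_right n (hη j).le
  have e : (η₀ - 2 * η j) * n = η₀ * n - 2 * (η j * n) := by rw [Nat.sub_mul, mul_assoc]
  omega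

/-- **`R(t−1) = C_n · (Lai core at r = 0)(t+1)`** with `B` tail bricks: the face function `tailRQ` of
`WellPoisedFaceTailLinearFormsPF` is Lai's unit-block function with `J = B`, `r = 0`, `M = η₀`, `δ = η`. -/
theorem tailRQ_eq_laiCore (hη : ∀ j, 2 * η j < η₀) (t : ℚ) :
    tailRQ η₀ η n t = laiC B 0 η₀ n η * laiCore B 0 η₀ n η (t + 1) := by
  have hB : ∀ j : Fin B,
      (∏ i ∈ range ((η₀ * n + 2) - 2 * (η j * n + 1) + 1), (t + ((η j * n + 1 : ℕ) : ℚ) + (i : ℚ)))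
        = ∏ i ∈ range ((η₀ - 2 * η j) * n + 1), (t + 1 + (η j : ℚ) * n + (i : ℚ)) := by
    intro j
    rw [tailLen_eq η₀ η n hη j]
    refine prod_congr rfl fun i _ => ?_
    push_cast; ring
  have hF : ∀ j : Fin B, ((((η₀ * n + 2) - 2 * (η j * n + 1)).factorial : ℕ) : ℚ)
      = ((((η₀ - 2 * η j) * n).factorial : ℕ) : ℚ) := by
    intro j; rw [tailLen_eq η₀ η n hη j]
  simp only [tailRQ, laiC, laiCore, laiNum, laiDen, laiBlock, hB, hF, mul_zero, zero_mul, pow_zero, div_one,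
    prod_range_zero, mul_one, prod_div_distrib]
  push_cast
  ring

/-! ## 3. Lai data for the face -/

/-- The set of Lai-form partial-fraction data of the `B`-brick face on the frame `(t+1)_{η₀n+1}`
(`J = B`, `r = 0`, `M = η₀`, `δ = η`). -/
def laiTailData : Set (ℕ → ℕ → ℚ) :=
  {c | ∀ t : ℚ, (∀ p : ℕ, p ≤ η₀ * n → t + p + 1 ≠ 0) →
    pfEval (η₀ * n) B c t = ((laiPoly B 0 η₀ n η).comp (X + C 1)).eval t / poch (t + 1) (η₀ * n + 1) ^ B}

/-- Lai data exist for `B ≥ 3` (`lai_pf_exists`; the degree condition is `Σ_j 2η_j n + 3 ≤ B(η₀ n + 1)`). -/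
theorem exists_laiTailData (hB : 3 ≤ B) (hη : ∀ j, 2 * η j < η₀) : ∃ c, c ∈ laiTailData η₀ η n := by
  have h : ∀ j, 2 * (η j * n) ≤ η₀ * n := fun j => by
    rw [← mul_assoc]; exact Nat.mul_le_mul_right n (hη j).le
  have hs : ∑ j, 2 * (η j * n) ≤ ∑ _j : Fin B, η₀ * n := sum_le_sum fun j _ => h j
  rw [sum_const, card_univ, Fintype.card_fin, smul_eq_mul] at hs
  obtain ⟨c, hc⟩ := lai_pf_exists B 0 η₀ n η (by omega) (by rw [mul_add, mul_one]; omega)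
  exact ⟨c, hc⟩

/-- The face data: `ĉ_{o,p} = C_n · c_{o,p}` on `o < B`, `p ≤ η₀ n`, zero elsewhere. -/
def tailDataOf (c : ℕ → ℕ → ℚ) : ℕ → ℕ → ℚ := fun o p =>
  if o < B ∧ p ≤ η₀ * n then laiC B 0 η₀ n η * c o p else 0

/-- `pfEval` of the face data is `C_n · pfEval` of the Lai data. -/
theorem pfEval_tailDataOf (c : ℕ → ℕ → ℚ) (t : ℚ) :
    pfEval (η₀ * n) B (tailDataOf η₀ η n c) t = laiC B 0 η₀ n η * pfEval (η₀ * n) B c t := by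
  unfold pfEval tailDataOf
  rw [mul_sum]
  refine sum_congr rfl fun p hp => ?_
  rw [mul_sum]
  refine sum_congr rfl fun o ho => ?_
  rw [if_pos ⟨mem_range.1 ho, Nat.lt_succ_iff.1 (mem_range.1 hp)⟩]
  ring

/-- **The face data are partial-fraction data of `R(t−1)` on the frame `(t+1)_{η₀n+1}`** (the hypothesis
`hc` of `WellPoisedFaceTailLinearForms`, with `C = 0`). -/
theorem tailRQ_eq_pfEval (hη : ∀ j, 2 * η j < η₀) {c : ℕ → ℕ → ℚ} (hc : c ∈ laiTailData η₀ η n)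
    (t : ℚ) (ht : ∀ p : ℕ, p ≤ η₀ * n → t + p + 1 ≠ 0) :
    tailRQ η₀ η n t = pfEval (η₀ * n) B (tailDataOf η₀ η n c) t + (0 : ℚ) := by
  have hδ : ∀ j, 2 * η j ≤ η₀ := fun j => (hη j).le
  have hu : ∀ p : ℕ, p ≤ η₀ * n → t + 1 + p ≠ 0 := fun p hp h => ht p hp (by linarith)
  rw [add_zero, pfEval_tailDataOf, tailRQ_eq_laiCore η₀ η n hη t, laiCore_eq_pfEval B 0 η₀ n η hδ hc hu,
    add_sub_cancel_right]

/-! ## 4. Integrality and windows of the face data ([Zudilin2004, (8.10)] and Lemma 16) -/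

/-- **(8.10) on the face: `D_{(η₀−2η_(1))n}^{B−1−o} · ĉ_{o,p} ∈ ℤ`** for a sorted direction
(`lai_pf_isInt` inside the big window, `lai_pf_eq_zero_of_lt` outside it). -/
theorem tailData_isInt (hs : Monotone η) (hη : ∀ j, 2 * η j < η₀) (hB : 0 < B)
    {c : ℕ → ℕ → ℚ} (hc : c ∈ laiTailData η₀ η n) :
    IsInt B (Nat.lcmUpto ((η₀ - 2 * etaB η 0) * n)) (tailDataOf η₀ η n c) := by
  have hδ : ∀ j, 2 * η j ≤ η₀ := fun j => (hη j).le
  have hM : 0 < η₀ := by have := hη ⟨0, hB⟩; omega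
  have e0 : etaB η 0 = η ⟨0, hB⟩ := etaB_of_lt η 0 hB
  have hmin : ∀ j, etaB η 0 ≤ η j := fun j => by
    rw [e0]; exact hs (Fin.mk_le_of_le_val (Nat.zero_le _))
  have h2 : 2 * etaB η 0 < η₀ := by rw [e0]; exact hη _
  intro o p
  by_cases hop : o < B ∧ p ≤ η₀ * n
  · simp only [tailDataOf, if_pos hop]
    by_cases hwin : etaB η 0 * n ≤ p ∧ p ≤ (η₀ - etaB η 0) * n
    · obtain ⟨z, hz⟩ := lai_pf_isInt B 0 η₀ n η hδ hc (etaB η 0) hmin h2 hwin.1 hwin.2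
        (s := o + 1) (by omega) (by omega)
      have e1 : B - (o + 1) = B - 1 - o := by omega
      rw [e1, Nat.add_sub_cancel] at hz
      exact ⟨z, hz⟩
    · have hk : ∀ j, p < η j * n ∨ (η₀ - η j) * n < p := by
        intro j
        rcases not_and_or.1 hwin with h | h
        · exact Or.inl (lt_of_lt_of_le (not_le.1 h) (Nat.mul_le_mul_right n (hmin j)))
        · exact Or.inr (lt_of_le_of_lt (Nat.mul_le_mul_right n (Nat.sub_le_sub_left (hmin j) η₀)) (not_le.1 h))
      have hz : c o p = 0 := lai_pf_eq_zero_of_lt B 0 η₀ n η hδ hM hc hk hop.2 hop.1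
      exact ⟨0, by rw [hz]; simp⟩
  · exact ⟨0, by simp only [tailDataOf, if_neg hop]; simp⟩

/-- **Windows (Lemma 16 on the face): `ĉ_{o,p} ≠ 0 ⇒ η_o n ≤ p ≤ (η₀ − η_o)n`** for a sorted direction
(`lai_pf_mem_block`). -/
theorem tailData_window (hs : Monotone η) (hη : ∀ j, 2 * η j < η₀) {c : ℕ → ℕ → ℚ}
    (hc : c ∈ laiTailData η₀ η n) {o p : ℕ} (ho : o < B) (hne : tailDataOf η₀ η n c o p ≠ 0) :
    etaB η o * n ≤ p ∧ p ≤ (η₀ - etaB η o) * n := by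
  have hδ : ∀ j, 2 * η j ≤ η₀ := fun j => (hη j).le
  have hM : 0 < η₀ := by have := hη ⟨o, ho⟩; omega
  by_cases hop : o < B ∧ p ≤ η₀ * n
  · simp only [tailDataOf, if_pos hop] at hne
    have hne' : c o p ≠ 0 := fun h => hne (by rw [h, mul_zero])
    rw [etaB_of_lt η o ho]
    exact lai_pf_mem_block B 0 η₀ n η hδ hM hs hc hop.2 ho hne'
  · exact absurd (by simp only [tailDataOf, if_neg hop]) hne

/-! ## 5. Reindexing the odd window -/

/-- Dropping the vanishing orders (`o = 0` and `o` odd) and reindexing `s = o + 3`: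
`Σ_{o<B} g_o ζ(o+3) = Σ_{s odd, 3<s≤B+2} g_{s−3} ζ(s)`. -/
theorem sum_oddWindow_eq (g : ℕ → ℚ) (h0 : g 0 = 0) (hpar : ∀ o, o < B → Odd o → g o = 0) :
    ∑ o ∈ range B, (g o : ℝ) * zetaValue (o + 3)
      = ∑ s ∈ (Ioc 3 (B + 2)).filter Odd, (g (s - 3) : ℝ) * zetaValue s := by
  have hre : ∑ s ∈ Ico 3 (B + 3), (g (s - 3) : ℝ) * zetaValue s
      = ∑ o ∈ range B, (g o : ℝ) * zetaValue (o + 3) := by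
    rw [Finset.sum_Ico_eq_sum_range, Nat.add_sub_cancel]
    refine sum_congr rfl fun o _ => ?_
    rw [Nat.add_sub_cancel_left, add_comm 3 o]
  have hsub : (Ioc 3 (B + 2)).filter Odd ⊆ Ico 3 (B + 3) := by
    intro x hx
    rw [mem_filter, mem_Ioc] at hx
    rw [mem_Ico]
    omega
  have hvan : ∀ x ∈ Ico 3 (B + 3), x ∉ (Ioc 3 (B + 2)).filter Odd → (g (x - 3) : ℝ) * zetaValue x = 0 := by
    intro x hx hx'
    rw [mem_Ico] at hx
    rw [mem_filter, mem_Ioc] at hx'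
    by_cases h3 : x = 3
    · subst h3
      rw [Nat.sub_self, h0, Rat.cast_zero, zero_mul]
    · have hev : ¬Odd x := fun hodd => hx' ⟨⟨by omega, by omega⟩, hodd⟩
      have hodd : Odd (x - 3) := by
        rw [Nat.not_odd_iff_even, Nat.even_iff] at hev
        rw [Nat.odd_iff]
        omega
      rw [hpar (x - 3) (by omega) hodd, Rat.cast_zero, zero_mul]
  rw [← hre, Finset.sum_subset hsub hvan]

end Summit.KontsevichZagierPeriods.Zeta5Search.WellPoisedFaceRate
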